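import Summits.HubbardSuperconductivity.HubbardSuperconductivity.Theorems.AnisotropyChordTransferFibre3FinX3Eval

/-!
# Route `AnisotropyChord` / H0 rotor rung: FIN per-`L` GM₃ (X4), `L = 25` — rows `N₁` / D / side-condition cell facts, part `p63`

Kernel facts (`decide +kernel`) for cert cells 145, 146 of the per-`L` grid of `L = 25`: `xbnCellAny2` (row `N₁` on XB2 point wedges recomputed in the kernel, exporting the literal brackets `nt ⊇ T⁺ − 3λ₂` and `tb ⊇ T⁺·D`), `xdCellAnyN0` (row D, reads `nt`), `sdCellAnyZN` (side condition, reads `nt`); evaluators `…FinX3Eval`; constants from the compiled design probe (x3probe/x3plan, margins c ×0.985, b ×1.03, aD ×1.03); assembled in `…FinX3GM3TwentyFive`.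
Prover seat `hubbard-h0-rotor-p3` g8; helper for piece A = stmt-HubbardSuperconductivity-23918 of rung 19089 (`--supports`, helper class).
WHAT THIS IS NOT: nothing here proves superconductivity in the Hubbard model (rotor TARGET as worded stays FALSE, g15 verdict); kernel facts for the FIN certificate of ONE conditional reduction.  Tree imports only; zero data; standard axioms.
-/

set_option linter.dupNamespace false
set_option autoImplicit false

namespace Summit.HubbardSuperconductivity.HubbardSuperconductivity.Theorems.AnisotropyChord.Transfer.Fibre3

namespace FinXD

open FinXB FinCell Hole2

set_option maxHeartbeats 4000000 in
/-- row `N₁` of cell 145 of `L = 25` (`c = 27/50`), exporting `nt`, `tb`. [folklore] -/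
theorem xn25_145 : xbnCellAny2 25 (49/50 : ℚ) 3073942336231493 3150790894637281 (27/50 : ℚ) ((110096595936928 : ℤ), (180799733865631 : ℤ)) ((9331867319066168 : ℤ), (9633228703342713 : ℤ)) = true := by decide +kernel

set_option maxHeartbeats 4000000 in
/-- row D of cell 145 of `L = 25` (`aD = 3/40`). [folklore] -/
theorem xd25_145 : xdCellAnyN0 25 (49/50 : ℚ) 3073942336231493 3150790894637281 (3/40 : ℚ) ((110096595936928 : ℤ), (180799733865631 : ℤ)) = true := by decide +kernel

set_option maxHeartbeats 4000000 in
/-- side condition of cell 145 of `L = 25` (`c, b = 152/100, aD`). [folklore] -/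
theorem sd25_145 : sdCellAnyZN 25 (49/50 : ℚ) 100 3073942336231493 3150790894637281 ((27/50 : ℚ), (152 : ℕ), (3/40 : ℚ)) ((110096595936928 : ℤ), (180799733865631 : ℤ)) = true := by decide +kernel

set_option maxHeartbeats 4000000 in
/-- row `N₁` of cell 146 of `L = 25` (`c = 27/50`), exporting `nt`, `tb`. [folklore] -/
theorem xn25_146 : xbnCellAny2 25 (49/50 : ℚ) 3150790894637281 3229560667003213 (27/50 : ℚ) ((117181490022191 : ℤ), (193766705959994 : ℤ)) ((9569496481229665 : ℤ), (9882506399674002 : ℤ)) = true := by decide +kernel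

set_option maxHeartbeats 4000000 in
/-- row D of cell 146 of `L = 25` (`aD = 3/40`). [folklore] -/
theorem xd25_146 : xdCellAnyN0 25 (49/50 : ℚ) 3150790894637281 3229560667003213 (3/40 : ℚ) ((117181490022191 : ℤ), (193766705959994 : ℤ)) = true := by decide +kernel

set_option maxHeartbeats 4000000 in
/-- side condition of cell 146 of `L = 25` (`c, b = 156/100, aD`). [folklore] -/
theorem sd25_146 : sdCellAnyZN 25 (49/50 : ℚ) 100 3150790894637281 3229560667003213 ((27/50 : ℚ), (156 : ℕ), (3/40 : ℚ)) ((117181490022191 : ℤ), (193766705959994 : ℤ)) = true := by decide +kernel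

end FinXD

end Summit.HubbardSuperconductivity.HubbardSuperconductivity.Theorems.AnisotropyChord.Transfer.Fibre3
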